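import Summits.CriticalPhenomena.PercolationContinuityZ3.Theorems.PercAnnulusCrossingIICVolumeTailTuples
import Summits.CriticalPhenomena.PercolationContinuityZ3.Theorems.PercAnnulusCrossingIICSpanningTree
import HarnessLib

/-!
# The volume of Kesten's IIC has an exponential upper tail, II: EVERY tuple — `ν(⋂_a {0 ↔ q_a}) ≤ C^t · W→(q)` (lane RSW3, p1 gen 28)

builds on p205010 (kernel theorem, internal audit signed; external expert review pending) — USED through p1 gen 22's tree bound
(`…IICSpanningTree`, exact re-rooting needs `θ(p_c) = 0`); the reduction lemma of §1 is deterministic.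

RSW3 lane (LANE 3 `prim-rsw3`), seat `prim-rsw3-p1` (gen 28).  Helper file (`--supports stmt-CriticalPhenomena-4575`); no definitions,
no sorries.  Memo `run/shared/lean/prim/rsw3/P1-QM.md` §41.

Gen 22 (`exists_iicMeasure_real_biInter_openConn_le_pow_mul_prod_nearest_all_criticalProbI`): for sites `z_0 = 0, z_1, …, z_k` listed with
NEAREST-EARLIER parents (`p(i) < i`, `1 ≤ ‖z_i − z_{p(i)}‖ ≤ ‖z_i − z_j‖` for `j < i`), `ν(⋂_i {0 ↔ z_i}) ≤ C^k ∏_i π(‖z_i − z_{p(i)}‖)`.  The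
observation of gen 28: this is a bound for EVERY insertion order, by the ORDERED weight `W→` of part I.  A tuple `q : Fin t → ℤ^d` of a
moment sum may repeat sites or hit the root; reading it from its LAST entry and skipping repeated values produces such a listing whose
weight is `W→(q)` on the nose (a repeated or zero entry has `D_a(q) = 0`, `π(0) = 1`):

* **`exists_nearestParent_listing_of_tuple`** (deterministic) — for every `q : Fin t → ℤ^d` there are `k ≤ t`, `z`, `p` as above with
  `{z_0, …, z_k} = {0} ∪ range q`, `⋂_a {0 ↔ q_a} ⊆ ⋂_{i ≤ k} {0 ↔ z_i}` and `∏_{i=1}^{k} f(‖z_i − z_{p(i)}‖) = ∏_a f(D_a(q))` whenever `f(0) = 1`;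
* **`exists_iicMeasure_real_iInter_openConn_le_pow_mul_orderedWeight_criticalProbI`** — `p_c(ℤ^d)`, `d ≥ 2`, (A2)□ + `CU⁺_l`: there is
  `C ≥ 1` with **`ν(⋂_{a} {0 ↔ q_a}) ≤ C^t · ∏_a π_{p_c}(D_a(q))` for every IIC probability measure `ν` and EVERY tuple `q : Fin t → ℤ^d`**;
  `…_of_robustCondAnnulusUniq` (from `CU⁺_l` alone).
Part III (`…IICVolumeExponentialTail`): `E_ν V_n^t ≤ t!·(C n^d π(n))^t` and `ν(V_n ≥ λ n^d π(n)) ≤ 2 e^{−cλ}`.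
References: H. Kesten, Probab. Theory Relat. Fields 73 (1986) Thm. (8) [Kesten1986]; D. Basu, A. Sapozhnikov, ECP 22 (2017) Thm. 1.1;
R. C. Prim, Bell Syst. Tech. J. 36 (1957).
-/

noncomputable section

namespace Summit.CriticalPhenomena.PercolationContinuityZ3.Theorems.Crossing

open MeasureTheory Filter Topology Literature.Probability.Percolation Literature.Probability.LatticeModels
open Literature.Probability.Percolation.DCT16
open Summit.CriticalPhenomena.PercolationContinuityZ3.Theorems.SurfaceTension
open Summit.CriticalPhenomena.PercolationContinuityZ3.Theorems.Rsw3

variable {d : ℕ}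

/-! ## §1 Every tuple, read from its last entry and without repetitions, is a nearest-parent listing -/

/-- **EVERY TUPLE IS A NEAREST-PARENT LISTING WITH THE ORDERED WEIGHT** (deterministic): for `q : Fin t → ℤ^d` there are `k ≤ t`, sites
`z_0 = 0, z_1, …, z_k` and parents `p(i) < i` with `1 ≤ ‖z_i − z_{p(i)}‖_∞ ≤ ‖z_i − z_j‖_∞` (`j < i`), such that `{z_0, …, z_k} = {0} ∪ range q`,
`⋂_a {0 ↔ q_a} ⊆ ⋂_{1 ≤ i ≤ k} {0 ↔ z_i}`, and `∏_{i=1}^{k} f(‖z_i − z_{p(i)}‖_∞) = ∏_{a} f(D_a(q))` for every `f` with `f(0) = 1`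
(`D_a(q) = dist_∞(q_a, {0} ∪ {q_b : b > a})`; induction on `t`, the first entry of `cons x q` is appended LAST, with parent a nearest already
listed site, or skipped when `x ∈ {0} ∪ range q`, where `D_0 = 0`). [cite: Kesten1986, Thm. (8), (48)–(50)] -/
theorem exists_nearestParent_listing_of_tuple {t : ℕ} (q : Fin t → Site d) :
    ∃ (k : ℕ) (z : ℕ → Site d) (par : ℕ → ℕ), k ≤ t ∧ z 0 = 0 ∧
      (∀ i, 1 ≤ i → i ≤ k → par i < i) ∧
      (∀ i, 1 ≤ i → i ≤ k → 1 ≤ Site.supNorm (z i - z (par i))) ∧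
      (∀ i, 1 ≤ i → i ≤ k → ∀ j, j < i → Site.supNorm (z i - z (par i)) ≤ Site.supNorm (z i - z j)) ∧
      (Finset.range (k + 1)).image z = insert (0 : Site d) (Finset.univ.image q) ∧
      ((⋂ a, (openConn (0 : Site d) (q a) : Set (BondConfig (Site d)))) ⊆
        ⋂ i ∈ Finset.Icc 1 k, (openConn (0 : Site d) (z i) : Set (BondConfig (Site d)))) ∧
      (∀ f : ℕ → ℝ, f 0 = 1 →
        ∏ i ∈ Finset.Icc 1 k, f (Site.supNorm (z i - z (par i))) =
          ∏ a : Fin t, f (((insert (0 : Site d) ((Finset.univ.filter fun b : Fin t => a < b).image q)).inf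
            (fun w => ((Site.supNorm (q a - w) : ℕ) : ℕ∞))).toNat)) := by
  classical
  induction t with
  | zero =>
    refine ⟨0, fun _ => 0, fun _ => 0, le_rfl, rfl, fun i h1 h2 => by omega, fun i h1 h2 => by omega,
      fun i h1 h2 => by omega, ?_, ?_, fun f _ => ?_⟩
    · rw [Finset.univ_eq_empty, Finset.image_empty, zero_add, Finset.range_one, Finset.image_singleton]
      simp
    · intro ω _
      simp
    · rw [Finset.univ_eq_empty, Finset.prod_empty, show Finset.Icc 1 0 = ∅ by rfl, Finset.prod_empty]
  | succ t ih =>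
    -- split `q = cons x q'`
    set x : Site d := q 0 with hx
    set q' : Fin t → Site d := Fin.tail q with hq'
    have hq : q = Fin.cons x q' := (Fin.cons_self_tail q).symm
    rw [hq]
    obtain ⟨k, z, par, hkt, hz0, hpar, hfar, hnear, hval, hev, hprod⟩ := ih q'
    set L : Finset (Site d) := insert (0 : Site d) (Finset.univ.image q') with hL
    -- the head weight `D_0(cons x q')` is the infimum over `L`
    have hD0 : ∀ f : ℕ → ℝ, ∏ a : Fin (t + 1), f (((insert (0 : Site d)
        ((Finset.univ.filter fun b : Fin (t + 1) => a < b).image (Fin.cons x q' : Fin (t + 1) → Site d))).inf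
          (fun w => ((Site.supNorm ((Fin.cons x q' : Fin (t + 1) → Site d) a - w) : ℕ) : ℕ∞))).toNat) =
        f ((L.inf (fun w => ((Site.supNorm (x - w) : ℕ) : ℕ∞))).toNat) *
          ∏ a : Fin t, f (((insert (0 : Site d) ((Finset.univ.filter fun b : Fin t => a < b).image q')).inf
            (fun w => ((Site.supNorm (q' a - w) : ℕ) : ℕ∞))).toNat) :=
      fun f => prod_orderedWeight_cons f x q'
    -- the event of `cons x q'`
    have hevcons : (⋂ a, (openConn (0 : Site d) ((Fin.cons x q' : Fin (t + 1) → Site d) a) : Set (BondConfig (Site d)))) ⊆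
        (openConn (0 : Site d) x : Set (BondConfig (Site d))) ∩
          ⋂ i ∈ Finset.Icc 1 k, (openConn (0 : Site d) (z i) : Set (BondConfig (Site d))) := by
      intro ω hω
      rw [Set.mem_iInter] at hω
      refine ⟨by simpa only [Fin.cons_zero] using hω 0, hev ?_⟩
      rw [Set.mem_iInter]
      intro a
      simpa only [Fin.cons_succ] using hω a.succ
    have hvalcons : insert (0 : Site d) (Finset.univ.image (Fin.cons x q' : Fin (t + 1) → Site d)) = insert x L := by
      rw [image_univ_cons, Finset.insert_comm]
    by_cases hxL : x ∈ L
    · -- Case A: `x` is the root or a repeated site — skip it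
      have hinf0 : (L.inf (fun w => ((Site.supNorm (x - w) : ℕ) : ℕ∞))).toNat = 0 := by
        have h1 : L.inf (fun w => ((Site.supNorm (x - w) : ℕ) : ℕ∞)) ≤ ((Site.supNorm (x - x) : ℕ) : ℕ∞) :=
          Finset.inf_le hxL
        rw [sub_self, Site.supNorm_eq_zero_iff.2 rfl] at h1
        have h2 : L.inf (fun w => ((Site.supNorm (x - w) : ℕ) : ℕ∞)) = 0 := nonpos_iff_eq_zero.1 (by exact_mod_cast h1)
        rw [h2]; rfl
      refine ⟨k, z, par, by omega, hz0, hpar, hfar, hnear, ?_, ?_, fun f hf0 => ?_⟩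
      · rw [hvalcons, Finset.insert_eq_of_mem hxL]; exact hval
      · exact hevcons.trans Set.inter_subset_right
      · rw [hD0 f, hinf0, hf0, one_mul, hprod f hf0]
    · -- Case B: `x` is new — append it with a nearest listed parent
      have hLz : L = (Finset.range (k + 1)).image z := hval.symm
      obtain ⟨j₀, hj₀, hj₀eq⟩ := Finset.exists_mem_eq_inf (Finset.range (k + 1))
        ⟨0, Finset.mem_range.2 (Nat.succ_pos k)⟩ (fun j => ((Site.supNorm (x - z j) : ℕ) : ℕ∞))
      have hj₀k : j₀ < k + 1 := Finset.mem_range.1 hj₀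
      -- the new data
      refine ⟨k + 1, fun i => if i = k + 1 then x else z i, fun i => if i = k + 1 then j₀ else par i, by omega, ?_, ?_, ?_, ?_,
        ?_, ?_, fun f hf0 => ?_⟩
      · simp only [show (0 : ℕ) ≠ k + 1 by omega, if_false]; exact hz0
      · intro i h1 h2
        by_cases hi : i = k + 1
        · simp only [hi, if_true]; exact hj₀k
        · simp only [hi, if_false]; exact hpar i h1 (by omega)
      · intro i h1 h2
        by_cases hi : i = k + 1
        · subst hi
          simp only [if_true, show j₀ ≠ k + 1 by omega, if_false]
          -- `x ≠ z j₀` because `z j₀ ∈ L` and `x ∉ L`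
          have hzL : z j₀ ∈ L := by rw [hLz]; exact Finset.mem_image_of_mem z hj₀
          have hne : x - z j₀ ≠ 0 := by
            intro h; exact hxL (by rwa [sub_eq_zero.1 h])
          have h0 : Site.supNorm (x - z j₀) ≠ 0 := fun h => hne (Site.supNorm_eq_zero_iff.1 h)
          omega
        · have hpi : par i ≠ k + 1 := by have := hpar i h1 (by omega); omega
          simp only [hi, if_false, hpi]
          exact hfar i h1 (by omega)
      · intro i h1 h2 j hj
        by_cases hi : i = k + 1
        · subst hi
          have hjne : j ≠ k + 1 := by omega
          simp only [if_true, show j₀ ≠ k + 1 by omega, if_false, hjne]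
          have hle : (Finset.range (k + 1)).inf (fun j => ((Site.supNorm (x - z j) : ℕ) : ℕ∞)) ≤
              ((Site.supNorm (x - z j) : ℕ) : ℕ∞) := Finset.inf_le (Finset.mem_range.2 (by omega))
          rw [hj₀eq] at hle
          exact_mod_cast hle
        · have hpi : par i ≠ k + 1 := by have := hpar i h1 (by omega); omega
          have hjne : j ≠ k + 1 := by omega
          simp only [hi, if_false, hpi, hjne]
          exact hnear i h1 (by omega) j hj
      · -- value set
        rw [hvalcons, Finset.range_add_one, Finset.image_insert, if_pos rfl, hLz]
        congr 1
        refine Finset.image_congr fun j hj => ?_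
        have hjne : j ≠ k + 1 := by have := Finset.mem_range.1 (Finset.mem_coe.1 hj); omega
        simp only [hjne, if_false]
      · -- event
        refine hevcons.trans fun ω hω => ?_
        rw [Set.mem_iInter₂]
        intro i hi
        rw [Finset.mem_Icc] at hi
        by_cases hik : i = k + 1
        · simp only [hik, if_true]; exact hω.1
        · simp only [hik, if_false]
          exact Set.mem_iInter₂.1 hω.2 i (Finset.mem_Icc.2 ⟨hi.1, by omega⟩)
      · -- product
        have hIcc : Finset.Icc 1 (k + 1) = insert (k + 1) (Finset.Icc 1 k) := by
          ext i; simp only [Finset.mem_Icc, Finset.mem_insert]; omega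
        have hnot : k + 1 ∉ Finset.Icc 1 k := by simp
        rw [hIcc, Finset.prod_insert hnot, hD0 f, ← hprod f hf0]
        congr 1
        · simp only [if_true, show j₀ ≠ k + 1 by omega, if_false]
          rw [hLz, Finset.inf_image]
          have hcomp : ((fun w => ((Site.supNorm (x - w) : ℕ) : ℕ∞)) ∘ z) = fun j => ((Site.supNorm (x - z j) : ℕ) : ℕ∞) := rfl
          rw [hcomp, hj₀eq, ENat.toNat_coe]
        · refine Finset.prod_congr rfl fun i hi => ?_
          rw [Finset.mem_Icc] at hi
          have hik : i ≠ k + 1 := by omega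
          have hpi : par i ≠ k + 1 := by have := hpar i hi.1 hi.2; omega
          simp only [hik, if_false, hpi]

/-! ## §2 The tree bound for every tuple -/

open Classical in
/-- **THE k-POINT FUNCTION OF KESTEN'S IIC ALONG EVERY TUPLE IS AT MOST `C^t` TIMES ITS ORDERED WEIGHT** (`p_c(ℤ^d)`, `d ≥ 2`; (A2)□ at aspect
`(s,L)`, `2 ≤ s ≤ L`, `ϰ > 0`; `CU⁺_l(c_U)`, `l ≥ 2`, `c_U > 0`): there is `C ≥ 1` such that for every IIC probability measure `ν`, every `t`
and EVERY `q : Fin t → ℤ^d` (repetitions and the root allowed):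
**`ν(⋂_{a} {0 ↔ q_a}) ≤ C^t · ∏_{a} π_{p_c}(D_a(q))`**, `D_a(q) = dist_∞(q_a, {0} ∪ {q_b : b > a})` — gen 22's nearest-parent bound read along
the listing of `exists_nearestParent_listing_of_tuple`. [cite: Kesten1986, Thm. (8)] [cite: BasuSapozhnikov2017ECP, Thm. 1.1 and Remark 2.1] -/
theorem exists_iicMeasure_real_iInter_openConn_le_pow_mul_orderedWeight_criticalProbI (hd : 2 ≤ d) {s L : ℕ} (hs : 2 ≤ s)
    (hsL : s ≤ L) {ϰ : ℝ} (hϰ : 0 < ϰ) (hA2 : SetToSetQuasiMultAspectAt d (criticalProbI d) s L ϰ) {l : ℕ} (hl : 2 ≤ l)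
    {cU : ℝ} (hcU : 0 < cU)
    (hCU : ∀ a : ℕ, 1 ≤ a → ∀ E : Set (BondConfig (Site d)), IsUpperSet E → MeasurableSet E →
      cU * (bondPercolation (zdGraph d) (criticalProbI d)).real E ≤ (bondPercolation (zdGraph d) (criticalProbI d)).real (E ∩
        {ω : BondConfig (Site d) | ∀ t ∈ innerBoundary (zdGraph d) (box d a), ∀ s ∈ innerBoundary (zdGraph d) (box d (l * a)),
          ∀ t' ∈ innerBoundary (zdGraph d) (box d a), ∀ s' ∈ innerBoundary (zdGraph d) (box d (l * a)),
          ω ∈ openConnIn (↑((box d (l * a) \ box d a) ∪ innerBoundary (zdGraph d) (box d a)) : Set (Site d)) t s →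
          ω ∈ openConnIn (↑((box d (l * a) \ box d a) ∪ innerBoundary (zdGraph d) (box d a)) : Set (Site d)) t' s' →
          ω ∈ openConnIn (↑((box d (l * a) \ box d a) ∪ innerBoundary (zdGraph d) (box d a)) : Set (Site d)) s s'})) :
    ∃ C : ℝ, 1 ≤ C ∧ ∀ (ν : Measure (BondConfig (Site d))) [IsProbabilityMeasure ν],
      (∀ (F : Finset (Sym2 (Site d))) (E : Set (BondConfig (Site d))), MeasurableSet E → DeterminedBy E ↑F →
        Tendsto (fun n : ℕ => (bondPercolation (zdGraph d) (criticalProbI d)).real (E ∩ siteToBoundary d n) /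
          oneArmProb d (criticalProbI d) n) atTop (𝓝 (ν.real E))) →
      ∀ (t : ℕ) (q : Fin t → Site d),
        ν.real (⋂ a, (openConn (0 : Site d) (q a) : Set (BondConfig (Site d)))) ≤
          C ^ t * ∏ a : Fin t, oneArmProb d (criticalProbI d) (((insert (0 : Site d)
            ((Finset.univ.filter fun b : Fin t => a < b).image q)).inf (fun w => ((Site.supNorm (q a - w) : ℕ) : ℕ∞))).toNat) := by
  have hd1 : 1 ≤ d := le_trans (by norm_num) hd
  obtain ⟨C, hC, hup⟩ :=
    exists_iicMeasure_real_biInter_openConn_le_pow_mul_prod_nearest_all_criticalProbI hd hs hsL hϰ hA2 hl hcU hCU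
  refine ⟨max C 1, le_max_right _ _, fun ν _ hν t q => ?_⟩
  obtain ⟨k, z, par, hkt, hz0, hpar, hfar, hnear, -, hev, hprod⟩ := exists_nearestParent_listing_of_tuple q
  have hπ0 : ∀ m, 0 ≤ oneArmProb d (criticalProbI d) m := fun m => measureReal_nonneg
  have hW0 : 0 ≤ ∏ a : Fin t, oneArmProb d (criticalProbI d) (((insert (0 : Site d)
      ((Finset.univ.filter fun b : Fin t => a < b).image q)).inf (fun w => ((Site.supNorm (q a - w) : ℕ) : ℕ∞))).toNat) :=
    Finset.prod_nonneg fun a _ => hπ0 _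
  have hCk : C ^ k ≤ (max C 1) ^ t :=
    (pow_le_pow_left₀ hC.le (le_max_left C 1) k).trans (pow_le_pow_right₀ (le_max_right C 1) hkt)
  calc ν.real (⋂ a, (openConn (0 : Site d) (q a) : Set (BondConfig (Site d))))
      ≤ ν.real (⋂ i ∈ Finset.Icc 1 k, (openConn (0 : Site d) (z i) : Set (BondConfig (Site d)))) :=
        measureReal_mono hev (measure_ne_top ν _)
    _ ≤ C ^ k * ∏ i ∈ Finset.Icc 1 k, oneArmProb d (criticalProbI d) (Site.supNorm (z i - z (par i))) :=
        hup ν hν k z par hz0 hpar hfar hnear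
    _ = C ^ k * ∏ a : Fin t, oneArmProb d (criticalProbI d) (((insert (0 : Site d)
          ((Finset.univ.filter fun b : Fin t => a < b).image q)).inf (fun w => ((Site.supNorm (q a - w) : ℕ) : ℕ∞))).toNat) := by
        rw [hprod (oneArmProb d (criticalProbI d)) (oneArmProb_zero hd1 _)]
    _ ≤ (max C 1) ^ t * ∏ a : Fin t, oneArmProb d (criticalProbI d) (((insert (0 : Site d)
          ((Finset.univ.filter fun b : Fin t => a < b).image q)).inf (fun w => ((Site.supNorm (q a - w) : ℕ) : ℕ∞))).toNat) :=
        mul_le_mul_of_nonneg_right hCk hW0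

open Classical in
/-- **The same from `CU⁺_l` ALONE** (`p_c(ℤ^d)`, `d ≥ 2`; robust conditional annulus-uniqueness `CU⁺_l(c_U)`, `l ≥ 2`, `c_U > 0`, which gives
(A2)□ at aspect `(l, l²)`): `ν(⋂_a {0 ↔ q_a}) ≤ C^t ∏_a π_{p_c}(D_a(q))` for every IIC probability measure and every tuple.
[cite: Kesten1986, Thm. (8)] [cite: BasuSapozhnikov2017ECP, Thm. 1.1] -/
theorem exists_iicMeasure_real_iInter_openConn_le_pow_mul_orderedWeight_of_robustCondAnnulusUniq (hd : 2 ≤ d) {l : ℕ}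
    (hl : 2 ≤ l) {cU : ℝ} (hcU : 0 < cU)
    (hCU : ∀ a : ℕ, 1 ≤ a → ∀ E : Set (BondConfig (Site d)), IsUpperSet E → MeasurableSet E →
      cU * (bondPercolation (zdGraph d) (criticalProbI d)).real E ≤ (bondPercolation (zdGraph d) (criticalProbI d)).real (E ∩
        {ω : BondConfig (Site d) | ∀ t ∈ innerBoundary (zdGraph d) (box d a), ∀ s ∈ innerBoundary (zdGraph d) (box d (l * a)),
          ∀ t' ∈ innerBoundary (zdGraph d) (box d a), ∀ s' ∈ innerBoundary (zdGraph d) (box d (l * a)),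
          ω ∈ openConnIn (↑((box d (l * a) \ box d a) ∪ innerBoundary (zdGraph d) (box d a)) : Set (Site d)) t s →
          ω ∈ openConnIn (↑((box d (l * a) \ box d a) ∪ innerBoundary (zdGraph d) (box d a)) : Set (Site d)) t' s' →
          ω ∈ openConnIn (↑((box d (l * a) \ box d a) ∪ innerBoundary (zdGraph d) (box d a)) : Set (Site d)) s s'})) :
    ∃ C : ℝ, 1 ≤ C ∧ ∀ (ν : Measure (BondConfig (Site d))) [IsProbabilityMeasure ν],
      (∀ (F : Finset (Sym2 (Site d))) (E : Set (BondConfig (Site d))), MeasurableSet E → DeterminedBy E ↑F →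
        Tendsto (fun n : ℕ => (bondPercolation (zdGraph d) (criticalProbI d)).real (E ∩ siteToBoundary d n) /
          oneArmProb d (criticalProbI d) n) atTop (𝓝 (ν.real E))) →
      ∀ (t : ℕ) (q : Fin t → Site d),
        ν.real (⋂ a, (openConn (0 : Site d) (q a) : Set (BondConfig (Site d)))) ≤
          C ^ t * ∏ a : Fin t, oneArmProb d (criticalProbI d) (((insert (0 : Site d)
            ((Finset.univ.filter fun b : Fin t => a < b).image q)).inf (fun w => ((Site.supNorm (q a - w) : ℕ) : ℕ∞))).toNat) := by
  have hA2 := setToSetQuasiMultAspectAt_of_robustCondAnnulusUniq hd hl hcU.le hCU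
  have hll : l ≤ l * l := Nat.le_mul_of_pos_left l (by omega)
  exact exists_iicMeasure_real_iInter_openConn_le_pow_mul_orderedWeight_criticalProbI hd hl hll (by positivity) hA2 hl hcU hCU

end Summit.CriticalPhenomena.PercolationContinuityZ3.Theorems.Crossing

end
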